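import Literature.Computability.Cryptography.PerfectRandomizedEncoding
import HarnessLib

/-!
# Perfect randomized encodings in the sense of Applebaum–Ishai–Kushilevitz (stretch-preserving case)

[Applebaum–Ishai–Kushilevitz 2006, Def. 4.6]: a randomized encoding
`f̂ : {0,1}ⁿ × {0,1}^m → {0,1}^s` of `f : {0,1}ⁿ → {0,1}^ℓ` is a **perfect randomized encoding** if
it is perfectly correct, perfectly private, balanced and stretch-preserving (`s = ℓ + m`).  By
AIK's "combinatorial view of perfect encoding" (§4.1) and their Lemma 4.12 (unique randomness) such
an `f̂` has, for every `x`, `f̂(x, ·)` INJECTIVE on `{0,1}^m`, with image a set `S_{f(x)}` of size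
exactly `2^m` that depends only on `f(x)`, the sets `S_y` being pairwise disjoint.  In the
blowup-parametrised vocabulary of the tree — `IsPerfectRandomizedEncoding f enc b`, the combinatorial
form of [Dvir–Gutfreund–Rothblum–Vadhan 2010, Def. 4.1] in `PerfectRandomizedEncoding.lean` — this
is precisely the case of MAXIMAL blowup `b = |ρ|` (`= 2^m` for `ρ = {0,1}^m`), which this file names:

`PerfectRandomizedEncoding f enc := IsPerfectRandomizedEncoding f enc (Fintype.card ρ)`.

## Main statements (all proved)

* `PerfectRandomizedEncoding.iff_injective` — AIK's combinatorial view: `enc` is a perfect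
  randomized encoding of `f` iff every `enc x` is injective in the randomness, outputs decode
  (`enc x r = enc x' r' → f x = f x'`), and the range of `enc x` depends only on `f x`;
  `injective` (Lemma 4.12, unique randomness), `decode`, `range_eq`, `card_image`
  (`|S_{f x}| = |ρ|`), `card_fiber_eq_one`; `surjective_uncurry_iff` — for `f` onto, the tiles
  `S_y` cover the whole output type iff it has `|β| · |ρ|` elements (AIK's balance clause in full
  strength, print `s = ℓ + m`).
* `iff_two_pow` / `of_two_pow` — for Boolean randomness `ρ = (Fin m → ZMod 2)`:
  `PerfectRandomizedEncoding f enc ↔ IsPerfectRandomizedEncoding f enc (2 ^ m)`, the form in which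
  the tree states its constructions — the degree-3 encoding of branching programs
  (`isPerfectRandomizedEncoding_encodeBDDsMap`, AIK Lemma 4.15, file `BranchingProgramEncoding.lean`)
  and of sparse polynomial maps (`isPerfectRandomizedEncoding_reduceInst`, DGRV Thm 4.5, file
  `PerfectRandomizedEncodingPolyMap.lean`) — so both are perfect randomized encodings in AIK's sense.
* `mapEntropy_uncurry_eq` / `mapEntropy_uncurry_eq_add` — the output entropy of a perfect randomized
  encoding on a uniform input: `H(f̂(U)) = H(f(U)) + log₂ |ρ|`, i.e. `+ m` for `m` random bits
  [DGRV 2010, Claim 4.4 and proof of Thm 4.6].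
* closure: `prod` (concatenation with independent randomness [AIK 2006, Lemma 4.9]), `pad`,
  `self`, `randomness`.

## Design choices / deviations from print

* This is a reducible specialisation (`abbrev`) of `IsPerfectRandomizedEncoding`, so every lemma of
  that namespace applies to `h : PerfectRandomizedEncoding f enc` by dot notation, and `h` can be
  passed wherever an `IsPerfectRandomizedEncoding f enc (Fintype.card ρ)` is expected.  It is named
  for the printed notion (AIK Def. 4.6, no blowup parameter); the `Is`-prefixed name is the
  blowup-parametrised DGRV predicate it specialises.
* As in `PerfectRandomizedEncoding.lean`, types are arbitrary (print: bit strings) and decoders /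
  simulators are not modelled as algorithms.  AIK's "balanced" clause in full strength — the tiles
  `S_y`, `y ∈ {0,1}^ℓ`, cover ALL of `{0,1}^s` (AIK, p. 9: "even perfect privacy and perfect
  correctness together do not promise that this mapping covers all of `{0,1}^s`") — refers to the
  ambient output space (and, for `f` not onto, to simulator outputs on non-values of `f`); it plays
  no role in the uses (unique randomness, entropy, concatenation) and is not a field of the
  predicate: `surjective_uncurry_iff` records that, for `f` onto, it holds iff `|γ| = |β| · |ρ|`.
* NOT here: statistical / computational encodings (AIK Def. 4.5), the composition lemma
  (AIK Lemma 4.11), efficiency of encoders/decoders.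

## References

* B. Applebaum, Y. Ishai, E. Kushilevitz, *Cryptography in NC⁰*, SIAM J. Comput. 36 (2006)
  845–888: Def. 4.6, §4.1 "A combinatorial view of perfect encoding", Lemma 4.9, Lemma 4.12.
  bib `ApplebaumIshaiKushilevitz2006`.
* Z. Dvir, D. Gutfreund, G. N. Rothblum, S. Vadhan, *On approximating the entropy of polynomial
  mappings*, ECCC TR10-160 (2010): Def. 4.1, Claim 4.4, Thm 4.5–4.6.
  bib `DvirGutfreundRothblumVadhan2010`.
-/

namespace Literature.Computability.Cryptography

open Finset Literature.InformationTheory.Entropy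

variable {α β γ ρ : Type*}

/-- **Perfect randomized encoding** (Applebaum–Ishai–Kushilevitz, Def. 4.6: perfectly correct,
perfectly private, balanced, stretch-preserving), combinatorial form: `enc : α → ρ → γ` is a perfect
randomized encoding of `f : α → β` when it is a perfect randomized encoding with the maximal blowup
`|ρ|` — equivalently (`iff_injective`, AIK's combinatorial view and Lemma 4.12) every `enc x` is
injective in the randomness, outputs of inputs with different `f`-values never coincide, and the
range of `enc x` depends only on `f x`.  Print: `f : {0,1}ⁿ → {0,1}^ℓ`,
`f̂ : {0,1}ⁿ × {0,1}^m → {0,1}^s`, blowup `2^m`; AIK's balance clause in full strength (the ranges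
`S_y`, `y ∈ {0,1}^ℓ`, tile the WHOLE output space `{0,1}^s`, `s = ℓ + m`) refers to the ambient
output type and is not imposed — see `surjective_uncurry_iff` and the module docstring.
[cite: ApplebaumIshaiKushilevitz2006, Def. 4.6] -/
abbrev PerfectRandomizedEncoding [Fintype ρ] [DecidableEq γ] (f : α → β) (enc : α → ρ → γ) : Prop :=
  IsPerfectRandomizedEncoding f enc (Fintype.card ρ)

namespace PerfectRandomizedEncoding

variable [Fintype ρ] [DecidableEq γ] {f : α → β} {enc : α → ρ → γ}

/-- A perfect randomized encoding is a perfect randomized encoding with blowup `|ρ|` (definitional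
unfolding). [cite: ApplebaumIshaiKushilevitz2006, Def. 4.6] -/
theorem isPerfectRandomizedEncoding (h : PerfectRandomizedEncoding f enc) :
    IsPerfectRandomizedEncoding f enc (Fintype.card ρ) := h

/-- A perfect randomized encoding with blowup `b = |ρ|` is a perfect randomized encoding.
[cite: ApplebaumIshaiKushilevitz2006, Def. 4.6] -/
theorem of_card_eq {b : ℕ} (h : IsPerfectRandomizedEncoding f enc b) (hb : b = Fintype.card ρ) :
    PerfectRandomizedEncoding f enc := by
  subst hb
  exact h

/-! ### AIK's combinatorial view -/

/-- **Perfect encodings from unique randomness, decoding and ranges** (AIK's combinatorial view).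
[cite: ApplebaumIshaiKushilevitz2006, §4.1 p. 9 and Lemma 4.12] -/
theorem of_injective (hinj : ∀ x, Function.Injective (enc x))
    (hdec : ∀ x x' r r', enc x r = enc x' r' → f x = f x')
    (hrange : ∀ x x', f x = f x' → ∀ r, ∃ r', enc x' r' = enc x r) :
    PerfectRandomizedEncoding f enc :=
  IsPerfectRandomizedEncoding.of_injective hinj hdec hrange

/-- **Unique randomness**: every `enc x` is injective in the randomness.
[cite: ApplebaumIshaiKushilevitz2006, Lemma 4.12] -/
theorem injective (h : PerfectRandomizedEncoding f enc) (x : α) : Function.Injective (enc x) :=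
  IsPerfectRandomizedEncoding.injective_of_blowup_eq h x

/-- **Perfect correctness**: an output value determines `f x`. [cite: ApplebaumIshaiKushilevitz2006, Def. 4.6] -/
theorem decode (h : PerfectRandomizedEncoding f enc) {x x' : α} {r r' : ρ} (he : enc x r = enc x' r') :
    f x = f x' :=
  h.output_disjoint x x' r r' he

/-- **Perfect privacy** (range form): the range `S_{f x}` of `enc x` depends only on `f x`.
[cite: ApplebaumIshaiKushilevitz2006, §4.1 p. 9] -/
theorem range_eq (h : PerfectRandomizedEncoding f enc) {x x' : α} (hxx' : f x = f x') :
    Set.range (enc x) = Set.range (enc x') := by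
  ext z
  constructor
  · rintro ⟨r, rfl⟩
    obtain ⟨r', hr'⟩ := h.exists_enc_eq hxx' r
    exact ⟨r', hr'⟩
  · rintro ⟨r', rfl⟩
    obtain ⟨r, hr⟩ := h.exists_enc_eq hxx'.symm r'
    exact ⟨r, hr⟩

/-- **AIK's combinatorial view of perfect encoding**: `enc` is a perfect randomized encoding of `f`
iff every `enc x` is injective in the randomness (unique randomness), outputs decode `f` (the ranges
`S_y` of different `f`-values are disjoint), and the range of `enc x` depends only on `f x`.
[cite: ApplebaumIshaiKushilevitz2006, §4.1 p. 9 and Lemma 4.12] -/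
theorem iff_injective : PerfectRandomizedEncoding f enc ↔
    (∀ x, Function.Injective (enc x)) ∧ (∀ x x' r r', enc x r = enc x' r' → f x = f x') ∧
      ∀ x x', f x = f x' → Set.range (enc x) = Set.range (enc x') := by
  refine ⟨fun h => ⟨h.injective, h.output_disjoint, fun x x' hxx' => h.range_eq hxx'⟩,
    fun h => of_injective h.1 h.2.1 fun x x' hxx' r => ?_⟩
  have hz : enc x r ∈ Set.range (enc x') := h.2.2 x x' hxx' ▸ Set.mem_range_self r
  exact hz

/-- Every range `S_{f x}` has exactly `|ρ|` elements ("balanced" and "stretch-preserving": for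
`ρ = {0,1}^m`, `2^m` elements). [cite: ApplebaumIshaiKushilevitz2006, §4.1 p. 9] -/
theorem card_image (h : PerfectRandomizedEncoding f enc) (x : α) :
    (univ.image (enc x)).card = Fintype.card ρ :=
  h.balanced x

/-- Every attained output value has exactly one random string producing it. [cite: ApplebaumIshaiKushilevitz2006, Lemma 4.12] -/
theorem card_fiber_eq_one (h : PerfectRandomizedEncoding f enc) (x : α) (r : ρ) :
    (fiber univ (enc x) (enc x r)).card = 1 :=
  card_fiber_univ_of_injective (h.injective x) r

/-- With `f` onto, the joint range of the encoding has exactly `|β| · |ρ|` elements (`|β|` disjoint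
tiles `S_y` of `|ρ|` elements each). [cite: ApplebaumIshaiKushilevitz2006, §4.1 p. 9] -/
theorem card_image_uncurry_eq [Fintype α] [Fintype β] [DecidableEq β] (h : PerfectRandomizedEncoding f enc)
    (hf : Function.Surjective f) :
    ((univ : Finset (α × ρ)).image (Function.uncurry enc)).card = Fintype.card β * Fintype.card ρ := by
  rw [IsPerfectRandomizedEncoding.card_image_uncurry h, Finset.image_univ_of_surjective hf, Finset.card_univ,
    mul_comm]

/-- **Tiling** (AIK's balance clause in full strength, for `f` onto): the tiles `S_y` cover the
WHOLE output type — every `z : γ` is an encoding — iff the output type has exactly `|β| · |ρ|`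
elements (print: `s = ℓ + m`).  This clause refers to the ambient output space and is not part of
the predicate; this lemma records exactly when it holds.
[cite: ApplebaumIshaiKushilevitz2006, §4.1 p. 9] -/
theorem surjective_uncurry_iff [Fintype α] [Fintype β] [Fintype γ] [DecidableEq β]
    (h : PerfectRandomizedEncoding f enc) (hf : Function.Surjective f) :
    Function.Surjective (Function.uncurry enc) ↔ Fintype.card γ = Fintype.card β * Fintype.card ρ := by
  rw [← h.card_image_uncurry_eq hf]
  constructor
  · intro hs
    rw [Finset.image_univ_of_surjective hs, Finset.card_univ]
  · intro hc z
    have hz : z ∈ (univ : Finset (α × ρ)).image (Function.uncurry enc) := by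
      rw [Finset.eq_univ_of_card _ hc.symm]
      exact mem_univ z
    obtain ⟨p, -, hp⟩ := Finset.mem_image.1 hz
    exact ⟨p, hp⟩

/-! ### Boolean randomness: blowup `2^m` -/

/-- `|{0,1}^m| = 2^m` for the cube `Fin m → ZMod 2` (private twin of the many local copies in
this directory). [folklore] -/
private theorem card_boolCube (m : ℕ) : Fintype.card (Fin m → ZMod 2) = 2 ^ m := by
  rw [Fintype.card_fun, ZMod.card, Fintype.card_fin]

/-- With `m` random bits, a perfect randomized encoding is exactly a perfect randomized encoding
with blowup `2^m` — the form of `isPerfectRandomizedEncoding_encodeBDDsMap` (branching programs,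
AIK Lemma 4.15) and `isPerfectRandomizedEncoding_reduceInst` (sparse polynomial maps, DGRV Thm 4.5).
[cite: ApplebaumIshaiKushilevitz2006, Def. 4.6] -/
theorem iff_two_pow {m : ℕ} {enc : α → (Fin m → ZMod 2) → γ} :
    PerfectRandomizedEncoding f enc ↔ IsPerfectRandomizedEncoding f enc (2 ^ m) := by
  rw [← card_boolCube m]

/-- A perfect randomized encoding with `m` random bits and blowup `2^m` is a perfect randomized
encoding. [cite: ApplebaumIshaiKushilevitz2006, Def. 4.6] -/
theorem of_two_pow {m : ℕ} {enc : α → (Fin m → ZMod 2) → γ}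
    (h : IsPerfectRandomizedEncoding f enc (2 ^ m)) : PerfectRandomizedEncoding f enc :=
  iff_two_pow.2 h

/-! ### Output entropy -/

/-- **Entropy of a perfect randomized encoding**: `H(f̂(U_α × U_ρ)) = H(f(U_α)) + log₂ |ρ|`.
[cite: DvirGutfreundRothblumVadhan2010, Claim 4.4] -/
theorem mapEntropy_uncurry_eq [Fintype α] [DecidableEq β] [Nonempty α] [Nonempty ρ]
    (h : PerfectRandomizedEncoding f enc) :
    mapEntropy univ (Function.uncurry enc) = mapEntropy univ f + Real.logb 2 (Fintype.card ρ) :=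
  IsPerfectRandomizedEncoding.mapEntropy_uncurry_eq h

/-- **… with `m` random bits: `H(f̂(U)) = H(f(U)) + m`** — the entropy of a perfect (stretch-preserving)
encoding exceeds that of the encoded function by exactly the randomness length.
[cite: DvirGutfreundRothblumVadhan2010, Thm 4.6 (proof)] -/
theorem mapEntropy_uncurry_eq_add [Fintype α] [DecidableEq β] [Nonempty α] {m : ℕ}
    {enc : α → (Fin m → ZMod 2) → γ} (h : PerfectRandomizedEncoding f enc) :
    mapEntropy univ (Function.uncurry enc) = mapEntropy univ f + m := by
  rw [h.mapEntropy_uncurry_eq, card_boolCube, Nat.cast_pow, Nat.cast_ofNat, Real.logb_pow,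
    Real.logb_self_eq_one (by norm_num), mul_one]

/-! ### Closure properties -/

/-- **Concatenation** of perfect randomized encodings of `f₁`, `f₂` with independent randomness is a
perfect randomized encoding of `x ↦ (f₁ x, f₂ x)`. [cite: ApplebaumIshaiKushilevitz2006, Lemma 4.9] -/
theorem prod {β₁ β₂ γ₁ γ₂ ρ₁ ρ₂ : Type*} [Fintype ρ₁] [Fintype ρ₂] [DecidableEq γ₁] [DecidableEq γ₂]
    {f₁ : α → β₁} {f₂ : α → β₂} {enc₁ : α → ρ₁ → γ₁} {enc₂ : α → ρ₂ → γ₂}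
    (h₁ : PerfectRandomizedEncoding f₁ enc₁) (h₂ : PerfectRandomizedEncoding f₂ enc₂) :
    PerfectRandomizedEncoding (fun x => (f₁ x, f₂ x))
      (fun x (r : ρ₁ × ρ₂) => (enc₁ x r.1, enc₂ x r.2)) :=
  of_card_eq (IsPerfectRandomizedEncoding.prod h₁ h₂) (Fintype.card_prod _ _).symm

/-- **Padding** the output with fresh uniform randomness keeps an encoding perfect.
[cite: DvirGutfreundRothblumVadhan2010, Thm 4.6 (proof)] -/
theorem pad {κ : Type*} [Fintype κ] [DecidableEq κ] (h : PerfectRandomizedEncoding f enc) :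
    PerfectRandomizedEncoding f (fun x (r : ρ × κ) => (enc x r.1, r.2)) :=
  of_card_eq (IsPerfectRandomizedEncoding.pad h) (Fintype.card_prod _ _).symm

/-- Only the partition of the inputs into level sets of the target matters. [folklore] -/
theorem of_fiber_iff {β' : Type*} {g : α → β'} (h : PerfectRandomizedEncoding f enc)
    (hg : ∀ x x', g x = g x' ↔ f x = f x') : PerfectRandomizedEncoding g enc :=
  IsPerfectRandomizedEncoding.of_fiber_iff h hg

/-- `f` is a perfect randomized encoding of itself (no randomness). [folklore] -/
theorem self [DecidableEq β] (f : α → β) :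
    PerfectRandomizedEncoding f (fun x (_ : Unit) => f x) :=
  of_card_eq (IsPerfectRandomizedEncoding.self f) Fintype.card_unit.symm

/-- The randomness itself is a perfect randomized encoding of any constant function.
[cite: DvirGutfreundRothblumVadhan2010, Thm 4.6 (proof)] -/
theorem randomness [DecidableEq ρ] (α : Type*) :
    PerfectRandomizedEncoding (fun _ : α => PUnit.unit.{1}) (fun (_ : α) (r : ρ) => r) :=
  IsPerfectRandomizedEncoding.randomness α

end PerfectRandomizedEncoding

end Literature.Computability.Cryptography
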